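import Summits.Ventures.PercRepro.PuncturedLYMMatchingCols

/-!
# PercRepro — (SP) FOR `j = 2`, THE THEOREM: THE MATCHING WEIGHTS ARE NONNEGATIVE WITH ROW SUMS `r` AND COLUMN SUMS `1`
(p10, gen 30; continues PuncturedLYMMatching / PuncturedLYMMatchingCols)

* `rr_eq` — `r = n(n−1)(n−2) / (3 (n(n−1) − 2m))`; `den_pos` — the denominator is `6 #P > 0`;
* `a0_bounds`, `b2_bounds`, `omW_nonneg` — `0 ≤ a 0 ≤ 1`, `0 ≤ b 2 ≤ 1` (four polynomial inequalities in `n, m` with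
  `2 ≤ n`, `2m ≤ n`), hence every weight is nonnegative;
* `sum_sups_mW_eq` — **the row sums are exactly `r`**: for `k = 0` and `k = 2` by the definitions of `a 0` and `b 2`
  (with the degenerate cases `m = 0`, `u = 0` where `r = (n−2)/3`, `(n−1)/3`), for `k = 1` the cubic identity
  `n(n−1)(n−2) = 6mu(n−2) + u(u−1)(u−2) + 4m(m−1)(2m−1)` (`n = u + 2m`);
* `puncturedNMP_of_weights` — the finishing step of the master lemma (row sums `≥ #Y/#P`, column sums `≤ 1` ⟹ (SP));
* **`puncturedNMP_of_matching` — (SP) HOLDS FOR EVERY MATCHING CODE (`j = 2`)**, every `n`, every matching.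
Nothing here asserts (SP) for `j ≥ 3`.
-/

namespace PercRepro.PuncturedLYM

open Finset

variable {α : Type} [Fintype α] [DecidableEq α]

/-! ### The closed form of `r`, the row identities and the nonnegativity of the weights -/

/-- `r = n(n−1)(n−2) / (3 (n(n−1) − 2m))` (`P ≠ ∅`, `n ≥ 2`). -/
theorem rr_eq {D : Finset (Finset α)} (hD : IsCode 2 D) (hn : 2 ≤ Fintype.card α) (hP : 0 < (punctured 2 D).card) :
    rr α D = (Fintype.card α : ℚ) * (Fintype.card α - 1) * (Fintype.card α - 2) /
      (3 * ((Fintype.card α : ℚ) * (Fintype.card α - 1) - 2 * D.card)) := by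
  have h := rr_mul hD hn hP
  have hden : 3 * ((Fintype.card α : ℚ) * (Fintype.card α - 1) - 2 * D.card) ≠ 0 := by
    obtain ⟨h2, -⟩ := choose_two_three_cast hn
    have hPq : ((punctured 2 D).card : ℚ) + D.card = ((Fintype.card α).choose 2 : ℕ) := by
      exact_mod_cast card_punctured_two hD
    have hPpos : (0 : ℚ) < (punctured 2 D).card := by exact_mod_cast hP
    have : 3 * ((Fintype.card α : ℚ) * (Fintype.card α - 1) - 2 * D.card) = 6 * (punctured 2 D).card := by
      linear_combination (-3 : ℚ) * h2 - 6 * hPq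
    rw [this]
    positivity
  rw [eq_div_iff hden]
  exact h

/-- The global facts used below: `0 ≤ m`, `m = 0 ∨ 1 ≤ m`, `2m ≤ n`, `2 ≤ n`, all in `ℚ`. -/
theorem matching_facts {D : Finset (Finset α)} (hD : IsCode 2 D) (hn : 2 ≤ Fintype.card α) :
    (0 : ℚ) ≤ D.card ∧ ((D.card : ℚ) = 0 ∨ (1 : ℚ) ≤ D.card) ∧ 2 * (D.card : ℚ) ≤ Fintype.card α ∧
      (2 : ℚ) ≤ Fintype.card α := by
  refine ⟨by positivity, ?_, ?_, by exact_mod_cast hn⟩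
  · rcases Nat.eq_zero_or_pos D.card with h | h
    · left; exact_mod_cast h
    · right; exact_mod_cast h
  · exact_mod_cast two_mul_card_le hD

/-- The denominator of `r` is positive: `n(n−1) − 2m = 2 #P > 0`. -/
theorem den_pos {D : Finset (Finset α)} (hD : IsCode 2 D) (hn : 2 ≤ Fintype.card α) (hP : 0 < (punctured 2 D).card) :
    (0 : ℚ) < (Fintype.card α : ℚ) * (Fintype.card α - 1) - 2 * D.card := by
  obtain ⟨h2, -⟩ := choose_two_three_cast hn
  have hPq : ((punctured 2 D).card : ℚ) + D.card = ((Fintype.card α).choose 2 : ℕ) := by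
    exact_mod_cast card_punctured_two hD
  have hPpos : (0 : ℚ) < (punctured 2 D).card := by exact_mod_cast hP
  have : (Fintype.card α : ℚ) * (Fintype.card α - 1) - 2 * D.card = 2 * (punctured 2 D).card := by
    linear_combination (-1 : ℚ) * h2 - 2 * hPq
  rw [this]
  positivity

/-- `0 ≤ a 0 ≤ 1`. -/
theorem a0_bounds {D : Finset (Finset α)} (hD : IsCode 2 D) (hn : 2 ≤ Fintype.card α) (hP : 0 < (punctured 2 D).card) :
    0 ≤ a0 α D ∧ a0 α D ≤ 1 := by
  obtain ⟨hm0, hm01, hmn, hn2⟩ := matching_facts hD hn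
  have hden := den_pos hD hn hP
  unfold a0
  split_ifs with h
  · norm_num
  · have hm1 : (1 : ℚ) ≤ D.card := by
      rcases hm01 with h' | h'
      · exact absurd (by exact_mod_cast h' : D.card = 0) h
      · exact h'
    rw [rr_eq hD hn hP]
    unfold uQ
    set n : ℚ := (Fintype.card α : ℚ)
    set m : ℚ := (D.card : ℚ)
    have hden3 : (0 : ℚ) < 3 * (n * (n - 1) - 2 * m) := by linarith
    constructor
    · apply div_nonneg _ (by positivity)
      rw [sub_nonneg, div_le_div_iff₀ (by norm_num) hden3]
      nlinarith [mul_nonneg hm0 (by nlinarith : (0 : ℚ) ≤ n - 2 + n * (n - 1) - 2 * m)]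
    · rw [div_le_one (by positivity), sub_le_iff_le_add, div_le_iff₀ hden3]
      nlinarith [mul_nonneg hm0 (by nlinarith : (0 : ℚ) ≤ 2 * n ^ 2 - 3 * n + 2 - 4 * m)]

/-- `u ≥ 1` when `u ≠ 0`. -/
theorem one_le_uQ {D : Finset (Finset α)} (hD : IsCode 2 D) (h : uQ α D ≠ 0) : (1 : ℚ) ≤ uQ α D := by
  unfold uQ at h ⊢
  have h1 : ((Fintype.card α - 2 * D.card : ℕ) : ℚ) = (Fintype.card α : ℚ) - 2 * D.card := by
    rw [Nat.cast_sub (two_mul_card_le hD)]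
    push_cast
    ring
  rw [← h1] at h ⊢
  have : 0 < Fintype.card α - 2 * D.card := by
    rcases Nat.eq_zero_or_pos (Fintype.card α - 2 * D.card) with h2 | h2
    · exact absurd (by rw [h2]; simp) h
    · exact h2
  exact_mod_cast this

/-- `0 ≤ b 2 ≤ 1`. -/
theorem b2_bounds {D : Finset (Finset α)} (hD : IsCode 2 D) (hn : 2 ≤ Fintype.card α) (hP : 0 < (punctured 2 D).card) :
    0 ≤ b2 α D ∧ b2 α D ≤ 1 := by
  obtain ⟨hm0, hm01, hmn, hn2⟩ := matching_facts hD hn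
  have hden := den_pos hD hn hP
  unfold b2
  split_ifs with h
  · norm_num
  · have hu1 := one_le_uQ hD h
    rw [rr_eq hD hn hP]
    unfold uQ at hu1 ⊢
    set n : ℚ := (Fintype.card α : ℚ)
    set m : ℚ := (D.card : ℚ)
    have hden3 : (0 : ℚ) < 3 * (n * (n - 1) - 2 * m) := by linarith
    have hm2 : 0 ≤ 2 * m * (2 * m - 1) := by
      rcases hm01 with h' | h'
      · rw [h']; norm_num
      · nlinarith
    constructor
    · apply div_nonneg _ (by linarith)
      rw [sub_nonneg, div_le_div_iff₀ (by norm_num) hden3]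
      nlinarith [mul_nonneg (by linarith : (0 : ℚ) ≤ n - 2 * m - 1) (by nlinarith : (0 : ℚ) ≤ n * (n - 1))]
    · rw [div_le_one (by linarith), sub_le_iff_le_add, div_le_iff₀ hden3]
      nlinarith [mul_nonneg (by linarith : (0 : ℚ) ≤ n - 2 * m - 1) (by nlinarith : (0 : ℚ) ≤ n * (n - 1)),
        mul_nonneg (by linarith : (0 : ℚ) ≤ n) (by linarith : (0 : ℚ) ≤ n - 1 - 2 * m)]

/-- The weights are nonnegative. -/
theorem omW_nonneg {D : Finset (Finset α)} (hD : IsCode 2 D) (hn : 2 ≤ Fintype.card α) (hP : 0 < (punctured 2 D).card)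
    (X : Finset α) (y : α) : 0 ≤ omW α D X y := by
  obtain ⟨ha0, ha1⟩ := a0_bounds hD hn hP
  obtain ⟨hb0, hb1⟩ := b2_bounds hD hn hP
  unfold omW
  split_ifs
  · norm_num
  · rcases (by omega : kOf D X = 0 ∨ kOf D X = 1 ∨ 2 ≤ kOf D X) with h | h | h
    · rw [h]; exact ha0
    · rw [h]; show 0 ≤ (1 - b2 α D) / 2; linarith
    · have : aW α D (kOf D X) = 1 / 3 := by
        obtain ⟨k, hk⟩ := Nat.exists_eq_add_of_le' h
        rw [hk]
        rfl
      rw [this]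
      norm_num
  · rcases (by omega : kOf D X = 0 ∨ kOf D X = 1 ∨ 2 ≤ kOf D X) with h | h | h
    · rw [h]; show (0 : ℚ) ≤ 1 / 3; norm_num
    · rw [h]; show 0 ≤ (1 - a0 α D) / 2; linarith
    · have : bW α D (kOf D X) = b2 α D := by
        obtain ⟨k, hk⟩ := Nat.exists_eq_add_of_le' h
        rw [hk]
        rfl
      rw [this]
      exact hb0

/-- **The row sums are exactly `r`** at every `X ∈ P`. -/
theorem sum_sups_mW_eq {D : Finset (Finset α)} (hD : IsCode 2 D) (hn : 2 ≤ Fintype.card α)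
    (hP : 0 < (punctured 2 D).card) {X : Finset α} (hX : X ∈ punctured 2 D) :
    ∑ Y ∈ sups 2 X, mW α D X Y = rr α D := by
  rw [sum_sups_mW hD hX]
  obtain ⟨hXc, hXD⟩ := mem_punctured.1 hX
  have hk : kOf D X ≤ 2 := hXc ▸ kOf_le D X
  have hXM := card_union_matchedPts hD X
  rw [hXc] at hXM
  have hXMn : (X ∪ matchedPts D).card ≤ Fintype.card α := card_le_univ _
  have hrr := rr_eq hD hn hP
  have hden := den_pos hD hn hP
  set n : ℚ := (Fintype.card α : ℚ) with hn_def
  set m : ℚ := (D.card : ℚ) with hm_def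
  have hden3 : 3 * (n * (n - 1) - 2 * m) ≠ 0 := by linarith
  rcases (by omega : kOf D X = 0 ∨ kOf D X = 1 ∨ kOf D X = 2) with h | h | h
  · -- `k = 0`: `(n − 2m − 2)/3 + 2m · a 0 = r`
    rw [h]
    show (0 : ℚ) / 2 + (2 * m - 2 * (0 : ℕ)) * a0 α D + (n - 2 * m - 2 + (0 : ℕ)) * (1 / 3) = rr α D
    unfold a0 uQ
    rw [← hm_def, ← hn_def]
    split_ifs with hm
    · have hm' : m = 0 := by rw [hm_def]; exact_mod_cast hm
      rw [hm'] at hrr hden3 ⊢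
      rw [hrr, eq_div_iff hden3]
      ring
    · have hm' : m ≠ 0 := by rw [hm_def]; exact_mod_cast hm
      rw [hrr]
      field_simp
      ring
  · -- `k = 1`: `1/2 + (2m − 2) a 1 + (n − 2m − 1) b 1 = r` — the cubic identity; here `m ≥ 1` and `u ≥ 1`
    rw [h]
    show (1 : ℕ) / 2 + (2 * m - 2 * (1 : ℕ)) * ((1 - b2 α D) / 2) + (n - 2 * m - 2 + (1 : ℕ)) * ((1 - a0 α D) / 2)
      = rr α D
    have hm1 : D.card ≠ 0 := by
      intro h0
      have hM : matchedPts D = ∅ := by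
        rw [← card_eq_zero, card_matchedPts hD, h0]
      have : kOf D X = 0 := by
        unfold kOf
        rw [hM, inter_empty, card_empty]
      omega
    have hu1 : Fintype.card α - 2 * D.card ≠ 0 := by omega
    unfold a0 b2 uQ
    rw [← hm_def, ← hn_def]
    have hm1' : m ≠ 0 := by rw [hm_def]; exact_mod_cast hm1
    have hu1' : n - 2 * m ≠ 0 := by
      have : ((Fintype.card α - 2 * D.card : ℕ) : ℚ) = n - 2 * m := by
        rw [Nat.cast_sub (two_mul_card_le hD), hn_def, hm_def]
        push_cast
        ring
      rw [← this]
      exact_mod_cast hu1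
    rw [if_neg hm1, if_neg hu1', hrr]
    field_simp
    ring
  · -- `k = 2`: `1 + (2m − 4)/3 + u · b 2 = r`
    rw [h]
    show (2 : ℕ) / 2 + (2 * m - 2 * (2 : ℕ)) * (1 / 3) + (n - 2 * m - 2 + (2 : ℕ)) * b2 α D = rr α D
    unfold b2 uQ
    rw [← hm_def, ← hn_def]
    split_ifs with hu
    · -- `u = 0`: `n = 2m`, `r = (n − 1)/3`
      rw [hrr]
      have hn2m : n = 2 * m := by linarith
      rw [hn2m] at hden3 ⊢
      rw [eq_div_iff hden3]
      ring
    · rw [hrr]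
      field_simp
      ring

/-- The finishing step: weights with row sums `≥ #Y / #P` and column sums `≤ 1` give (SP) (the cut-off outside the
inclusion pairs makes the master lemma's global nonnegativity hypothesis available). -/
theorem puncturedNMP_of_weights {j : ℕ} {D : Finset (Finset α)} (w : Finset α → Finset α → ℚ)
    (hw : ∀ X ∈ punctured j D, ∀ Y ∈ sups j X, 0 ≤ w X Y)
    (hrow : ∀ X ∈ punctured j D, ((levelAbove α j).card : ℚ) / (punctured j D).card ≤ ∑ Y ∈ sups j X, w X Y)
    (hcol : ∀ Y ∈ levelAbove α j, ∑ X ∈ subsP j D Y, w X Y ≤ 1) : PuncturedNMP j D := by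
  intro 𝒜 h𝒜
  rcases Nat.eq_zero_or_pos (punctured j D).card with hP | hP
  · have : 𝒜 = ∅ := subset_empty.1 (card_eq_zero.1 hP ▸ h𝒜)
    subst this
    simp
  set w' : Finset α → Finset α → ℚ :=
    fun X Y => if X ∈ punctured j D ∧ Y ∈ sups j X then w X Y else 0 with hw'
  have hw0 : ∀ X Y, 0 ≤ w' X Y := by
    intro X Y
    simp only [hw']
    split_ifs with h
    · exact hw X h.1 Y h.2
    · exact le_rfl
  have hrow' : ∀ X ∈ punctured j D, ((levelAbove α j).card : ℚ) / (punctured j D).card ≤ ∑ Y ∈ sups j X, w' X Y := by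
    intro X hX
    have : ∑ Y ∈ sups j X, w' X Y = ∑ Y ∈ sups j X, w X Y := by
      apply sum_congr rfl
      intro Y hY
      simp only [hw', hX, hY, and_self, if_true]
    rw [this]
    exact hrow X hX
  have hcol' : ∀ Y ∈ levelAbove α j, ∑ X ∈ subsP j D Y, w' X Y ≤ 1 := by
    intro Y hY
    have : ∑ X ∈ subsP j D Y, w' X Y = ∑ X ∈ subsP j D Y, w X Y := by
      apply sum_congr rfl
      intro X hX
      have hX' := mem_subsP.1 hX
      have h1 : X ∈ punctured j D := mem_punctured.2 hX'.1
      have h2 : Y ∈ sups j X := mem_sups.2 ⟨mem_levelAbove.1 hY, hX'.2⟩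
      simp only [hw', h1, h2, and_self, if_true]
    rw [this]
    exact hcol Y hY
  have hmain := card_upNbhd_ge_of_weights w' _ hw0 hrow' hcol' h𝒜
  have hq : ((𝒜.card * (levelAbove α j).card : ℕ) : ℚ) ≤ ((upNbhd j 𝒜).card * (punctured j D).card : ℕ) := by
    push_cast
    have hPq : (0 : ℚ) < (punctured j D).card := by exact_mod_cast hP
    rw [mul_div_assoc', div_le_iff₀ hPq] at hmain
    linarith
  exact_mod_cast hq

/-- **(SP) FOR EVERY MATCHING CODE (`j = 2`)**: the explicit type-symmetric coupling `mW` has row sums `r = #Y/#P` and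
column sums `1`, and is nonnegative. -/
theorem puncturedNMP_of_matching {D : Finset (Finset α)} (hD : IsCode 2 D) : PuncturedNMP 2 D := by
  intro 𝒜 h𝒜
  rcases Nat.eq_zero_or_pos (punctured 2 D).card with hP | hP
  · have : 𝒜 = ∅ := subset_empty.1 (card_eq_zero.1 hP ▸ h𝒜)
    subst this
    simp
  have hn : 2 ≤ Fintype.card α := by
    obtain ⟨X, hX⟩ := card_pos.1 hP
    have := (mem_punctured.1 hX).1
    calc 2 = X.card := this.symm
      _ ≤ Fintype.card α := card_le_univ X
  refine puncturedNMP_of_weights (mW α D) ?_ ?_ ?_ 𝒜 h𝒜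
  · intro X hX Y hY
    obtain ⟨hXc, -⟩ := mem_punctured.1 hX
    rw [sups_eq hXc] at hY
    obtain ⟨y, hy, rfl⟩ := mem_image.1 hY
    rw [mW_insert D X (mem_sdiff.1 hy).2]
    exact omW_nonneg hD hn hP X y
  · intro X hX
    rw [sum_sups_mW_eq hD hn hP hX]
    exact le_rfl
  · intro Y hY
    have hYc := mem_levelAbove.1 hY
    by_cases hT : Touched D Y
    · rw [sum_subsP_mW_touched hD hYc hT]
    · rw [sum_subsP_mW_untouched hYc hT]

end PercRepro.PuncturedLYM
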